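/-
Copyright: lit-balaban Phase-2 proof seat p30 (gen 6).  Statement-level skeleton of a published paper; no proof claims beyond what
the kernel checks below.
-/
import Literature.MathematicalPhysics.QuantumFieldTheory.BalabanImbrieJaffe1984to88.BIJ85Eq625Torus
import Literature.MathematicalPhysics.QuantumFieldTheory.BalabanImbrieJaffe1984to88.BIJ85Eq454HolonomyBase0

/-!
# `BalabanImbrieJaffe1984to88.BIJ85Rem317Torus` — T. Bałaban, J. Imbrie, A. Jaffe, *Renormalization of the Higgs model: minimizers,
propagators and the stability of mean field theory*, Commun. Math. Phys. **97** (1985) 299–329 [BalabanImbrieJaffe1985]: **Remark 2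
p. 317, (5.2.11)–(5.2.12), AT THE TORUS MODEL INSTANCE** — *"The gauge field quadratic form ⟨f^{(k)},σ_kf^{(k)}⟩ can now be written
entirely as a function of the η-lattice gauge field u_k"* — and **(6.3.2) p. 320 for this quadratic form** (its invariance under
`u_k ↦ u_ke^{−iη∂λ}`): the hypotheses of seat p30's abstract `BIJ85Eq427Proof.eq5211`/`eq5212` ((4.2.2) `h422`, the projection property
`hproj`, Proposition 5.2.2 `h526`, `∂∂ = 0` `hdd`, the holonomy of (4.5.4) `hhol`) are ALL theorems of the tree's torus calculus —
σ_k = `BIJ85Sigma421Torus.sigmaTorus` ((4.2.1)–(4.2.2)), `∂G_{k,Ax}∂^*` idempotent (`BIJ85SigmaForm421.curlG_idem`, p09), (5.2.10)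
`∂G_{k,Ax}∂^* = ∂𝒟_k∂^*` (`BIJ85Prop522Torus.eq5210_torus`, p11, with `G_{k,Ax}` of (4.1.1) = the sum (5.2.2) by
`BIJ85Eq625Torus.axialPropagator_eq_GaxE`), and the plaquette variables of `u_k` (`BIJ85Eq454HolonomyBase0.plaqField_background531`, p31)

statement-level skeleton of published theorems with citation tags; proofs where landed; nothing here is a claim about the Yang–Mills mass gap

PDF held: `paper:balaban1985-cmp97-bij-higgs-minimizers` (journal page = PDF page + 298).  Pages read as images: pp. 310–311, 313, 317, 320
[PDF 12–13, 15, 19, 22] (`HOME/lit-balaban-r15/pages/1985-cmp97-bij-higgs-minimizers-p013,p015,p019,p022-x2.png`,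
`run/shared/lean/pub/pub-balaban/t4/b2b-balaban-t4-lit2/renders/bij1985/…-p012-x2.png`).

CITATION HEADER (lean-in-tree rule).  Part of the lit-balaban TYPED SKELETON (HOME `run/shared/lean/pub/lit-balaban/`), Phase-2
seat p30 (gen 6), unit `lit-balaban-p30`; WHAT IS REPRODUCED = rows **C1.Rem@317** (Remark 2; model instance), **C1.Eq4.2.4-4.2.7**
((4.2.6)–(4.2.7) on the tori) and **C1.Eq6.3.1-6.3.4** (member (6.3.2), the gauge-field quadratic form) of `HOME/SKELETON.md` (reader file
`HOME/lit-balaban-r15/ROWS-C1.md`) AT THE TORUS MODEL OF RECORD (kind «model-instance»).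

THE PRINTED TEXT (verbatim).  p. 317 [PDF 19]: *"Remark 2. The gauge field quadratic form ⟨f^{(k)},σ_kf^{(k)}⟩ can now be written
entirely as a function of the η-lattice gauge field u_k. In fact ⟨f^{(k)},σ_kf^{(k)}⟩ = Σ_{p∈T_η} η^d|f_k(p)|², (5.2.11) where f_k(p) =
(ie_kη²)^{−1} ln u_k(∂p). (5.2.12) This follows from the definition (4.5.4) of u_k, giving u_k(∂p) = exp[ie_kη²Q^{e*}_kf^{(k)} −
ie_kη²∂𝒟_k∂^*Q^{e*}_kf^{(k)}]. From this and (5.2.10) we get (ie_kη²)^{−1} ln u_k(∂p) = Q^{e*}_kf^{(k)} − ∂G_{k,Ax}∂^*Q^{e*}_kf^{(k)},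
coinciding with (4.2.6)."*; p. 311 [PDF 13]: *"f_k ≡ (I − ∂G_{k,Ax}∂^*)Q^{e*}_kf, (4.2.6) we have ⟨f, σ_kf⟩ = ‖f_k‖²_η … (4.2.7) This
identity is a consequence of the fact that ∂G_{k,Ax}∂^* is a projection operator"*; p. 320 [PDF 22]: *"Notice that every step of our
construction has been gauge covariant, which ensures that S_k(u_ke^{−iη∂λ}, e^{iλ}φ) = S_k(u_k, φ). (6.3.2) While we do not prove this
invariance here, it is clear in the case of the quadratic forms for which we write explicit formulas."*

THE TORUS DATA (as in `BIJ85Eq625Torus`): η-bond fields `BondSpace P`, η-plaquette fields `PlaqSpace P`, `∂ = curlOp w c` (`w = η^d`,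
`c = η⁻¹`; `√w·curl c` componentwise), `∂^* = LinearMap.adjoint (curlOp w c)`, unit plaquette fields `UnitPlaqSpace P k`, `Q^{e*}_k = QesOp hd
w k` (`√w·Q^{e*}_k` componentwise, `BIJ85Eq531Inputs.QestarIter hd k`), `σ_k = sigmaTorus hd w c k`, `∂G_{k,Ax}∂^* = curlG (V411 P k) ∂`,
`𝒟_k = DkE P w c k` ((4.4.4), Landau minimizers), `G_{k,Ax} = GaxE P w c k` ((5.2.2)); U(1) fields `U1Field P j`, `v = exp(ie_kB)` =
`expField e B` on the unit lattice `T^{(k)}`, the plaquette field `(ia)^{−1} ln u(∂p) = plaqField a u p` (branch (2.11)), `f^{(k)} = (ie_k)^{−1}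
ln v(∂·)` ((4.2.4)), `u_k = exp(ie_kη(Q^{s*}_kB − X))` = (4.5.4) with `X = 𝒟_k∂^*Q^{e*}_kf^{(k)}` (p31's typing of row C1.Eq4.5.4; by
`BIJ85Eq622Torus.expField_QsstarIter` (p30, pending) the first factor is the group-valued `Q^{s*}_kv` of (4.5.3)); gauge transformations
`gaugeU h u` ((2.7)), `u·e^{−iη∂λ} = gaugeU (e^{iλ}) u` for `∂ = grad c`, `ηc = 1` (`gaugeU_exp_eq_translate62`).

WHAT IS PROVED: `curlG_torus_eq_DkE` ((5.2.10) for p09's projection operator); **`eq427_torus`** ((4.2.7) on the tori: `⟨f, σ_kf⟩ =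
‖(I − ∂G_{k,Ax}∂^*)Q^{e*}_kf‖²`); **`eq5211_torus`** / `eq5211_torus_sum` ((5.2.11) with the 𝒟_k-form of the field: `⟨f, σ_kf⟩ = ‖Q^{e*}_kf −
∂𝒟_k∂^*Q^{e*}_kf‖² = Σ_p η^d|(Q^{e*}_kf)(p) − (∂𝒟_k∂^*Q^{e*}_kf)(p)|²`); `curl_GaxE_eq_curl_DkE` (componentwise (5.2.10)); **`rem2_torus`** =
REMARK 2 ON THE TORI: for `v = exp(ie_kB)`, `f^{(k)} = (ie_k)^{−1} ln v(∂·)`, `u_k` = (4.5.4), inside the branch of the logarithm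
(`|e_kη²f_k(p)| < π`, the small-field standing assumption), `⟨f^{(k)}, σ_kf^{(k)}⟩ = Σ_{p∈T_η} η^d|f_k(p)|²` with `f_k(p) = (ie_kη²)^{−1} ln u_k(∂p)`;
**`eq5212_torus`** ((5.2.12) = (4.2.6): `(ie_kη²)^{−1} ln u_k(∂p) = (Q^{e*}_kf^{(k)})(p) − (∂G_{k,Ax}∂^*Q^{e*}_kf^{(k)})(p)`); **(6.3.2) for the
gauge-field quadratic form**: `plaqField_gaugeU` (every plaquette field is gauge invariant, r15's `plaq_gauge`), `gaugeU_exp_eq_translate62`,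
`gaugeForm_gaugeU`, **`eq632_gaugeForm`** (`Σ_pη^d|f(u·e^{−iη∂λ})(p)|² = Σ_pη^d|f(u)(p)|²`), `rem2_torus_gauge` (hence the (5.2.11)-function of
`u_k` is unchanged under `u_k ↦ u_ke^{−iη∂λ}`; the scalar quadratic form is seat p11's `BIJ85ScalarPropagatorTorusK.scalarForm_gaugeAct`).
Standing range `k ≤ m + K`; `c ≠ 0` resp. `c = η⁻¹`, `w > 0`, `2 ≤ d`, `e ≠ 0`, `ηL^k = 1`.  D-0026: theorems only, no `def`, no new named
fact.  Unit `lit-balaban-p30` (literature-prover-lit-balaban-p30-g6-0), 2026-08-21.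
-/

open scoped BigOperators RealInnerProductSpace

namespace Literature.MathematicalPhysics.QuantumFieldTheory.BalabanImbrieJaffe1984to88.BIJ85Rem317Torus

open Literature.MathematicalPhysics.QuantumFieldTheory.Balaban1983to89
open LatticeFieldCalculus BIJ85Sect1Model BIJ85SmallFieldSplit64 BIJ85AxialPropagator411 BIJ85SigmaForm421 BIJ85UnitPropagator433
  BIJ85Prop521Proof BIJ85Prop521Torus BIJ85Sigma421Torus BIJ85Eq611Torus BIJ85LandauMinimizer442V1 BIJ85Prop511Torus
  BIJ85Prop522Torus BIJ85Eq531Inputs BIJ85Eq625Torus BIJ85Eq454HolonomyBase0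

noncomputable section

variable {P : Params} {j : ℕ}

/-! ## 1. (4.2.7) and (5.2.11) on the tori, operator form -/

/-- **(5.2.10) for p09's projection operator** `∂G_{k,Ax}∂^*` (`BIJ85SigmaForm421.curlG` at the torus data): `∂G_{k,Ax}∂^* = ∂𝒟_k∂^*` with
`𝒟_k = DkE` ((4.4.4)) — `G_{k,Ax}` of (4.1.1) is the sum (5.2.2) (`BIJ85Eq625Torus.axialPropagator_eq_GaxE`) and seat p11's Remark 1 on the
tori (`BIJ85Prop522Torus.eq5210_torus`); `k ≤ m + K`, `c ≠ 0`, `w > 0`. [cite: BalabanImbrieJaffe1985, (5.2.10) p.317] -/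
theorem curlG_torus_eq_DkE {k : ℕ} (hk : k ≤ P.m + P.K) {c : ℝ} (hc : c ≠ 0) {w : ℝ} (hw : 0 < w) :
    curlG (V411 P k) (curlOp (P := P) w c) =
      curlOp (P := P) w c ∘ₗ DkE P w c k ∘ₗ LinearMap.adjoint (curlOp (P := P) w c) := by
  rw [curlG, axialPropagator_eq_GaxE hc hw hk, eq5210_torus hk hc hw]

/-- **(4.2.6)–(4.2.7) ON THE TORI** p. 311 [PDF 13], verbatim: *"f_k ≡ (I − ∂G_{k,Ax}∂^*)Q^{e*}_kf, (4.2.6) we have ⟨f, σ_kf⟩ = ‖f_k‖²_η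
… (4.2.7) This identity is a consequence of the fact that ∂G_{k,Ax}∂^* is a projection operator"* — for the torus σ_k (`sigmaTorus`, η-norms
carried by the `√w` inside `QesOp`/`curlOp`): `⟨f, σ_kf⟩ = ‖Q^{e*}_kf − ∂G_{k,Ax}∂^*Q^{e*}_kf‖²` (p09's `inner_sigmaOp_eq_norm_sq`, no zero modes
p11's `hD_V411`; abstract version: p30's `BIJ85Eq427Proof.eq427`). [cite: BalabanImbrieJaffe1985, (4.2.7) p.311] -/
theorem eq427_torus (hd : 2 ≤ P.d) {k : ℕ} (hk : k ≤ P.m + P.K) {c : ℝ} (hc : c ≠ 0) {w : ℝ} (hw : 0 < w)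
    (f : UnitPlaqSpace P k) :
    ⟪f, sigmaTorus (P := P) hd w c k f⟫ =
      ‖QesOp (P := P) hd w k f - curlG (V411 P k) (curlOp (P := P) w c) (QesOp (P := P) hd w k f)‖ ^ 2 :=
  inner_sigmaOp_eq_norm_sq (hD_V411 hk hc hw) _ f

/-- **(5.2.11) ON THE TORI, operator form**: `⟨f, σ_kf⟩ = ‖Q^{e*}_kf − ∂𝒟_k∂^*Q^{e*}_kf‖²` — (4.2.7) with `∂G_{k,Ax}∂^*` replaced by `∂𝒟_k∂^*`
through (5.2.10) (`curlG_torus_eq_DkE`); `𝒟_k = DkE` (4.4.4) with the Landau minimizers; `k ≤ m + K`, `c ≠ 0`, `w > 0`, `2 ≤ d`.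
[cite: BalabanImbrieJaffe1985, (5.2.11) p.317] -/
theorem eq5211_torus (hd : 2 ≤ P.d) {k : ℕ} (hk : k ≤ P.m + P.K) {c : ℝ} (hc : c ≠ 0) {w : ℝ} (hw : 0 < w)
    (f : UnitPlaqSpace P k) :
    ⟪f, sigmaTorus (P := P) hd w c k f⟫ =
      ‖QesOp (P := P) hd w k f
        - curlOp (P := P) w c (DkE P w c k (LinearMap.adjoint (curlOp (P := P) w c) (QesOp (P := P) hd w k f)))‖ ^ 2 := by
  rw [eq427_torus hd hk hc hw, curlG_torus_eq_DkE hk hc hw]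
  rfl

/-- **(5.2.11) ON THE TORI as the printed η-lattice sum** `Σ_{p∈T_η} η^d|·|²`: `⟨f, σ_kf⟩ = Σ_p w·((Q^{e*}_kf)(p) − (∂X)(p))²`, `w = η^d`,
`X = 𝒟_k∂^*Q^{e*}_kf` the η-bond field of (4.5.4), `∂ = curl c` (gen 3's `norm_sq_curlOp_sub_QesOp`). [cite: BalabanImbrieJaffe1985, (5.2.11) p.317] -/
theorem eq5211_torus_sum (hd : 2 ≤ P.d) {k : ℕ} (hk : k ≤ P.m + P.K) {c : ℝ} (hc : c ≠ 0) {w : ℝ} (hw : 0 < w)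
    (f : UnitPlaqSpace P k) :
    ⟪f, sigmaTorus (P := P) hd w c k f⟫ =
      ∑ p : Plaq P 0, w * (QestarIter hd k (fun q => f q) p
        - curl c (WithLp.ofLp (DkE P w c k (LinearMap.adjoint (curlOp (P := P) w c) (QesOp (P := P) hd w k f)))) p) ^ 2 := by
  rw [eq5211_torus hd hk hc hw, norm_sub_rev, norm_sq_curlOp_sub_QesOp hd hw.le]
  refine Finset.sum_congr rfl fun p _ => ?_
  rw [← neg_sub, neg_sq]
  rfl

/-- **(5.2.10) componentwise**: `(∂G_{k,Ax}∂^*J)(p) = (∂𝒟_k∂^*J)(p)` for every plaquette source `J` and every η-plaquette `p` (`∂ = curl c`;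
from p11's `eq5210_torus`, the factor `√w` cancelled). [cite: BalabanImbrieJaffe1985, (5.2.10) p.317] -/
theorem curl_GaxE_eq_curl_DkE {k : ℕ} (hk : k ≤ P.m + P.K) {c : ℝ} (hc : c ≠ 0) {w : ℝ} (hw : 0 < w) (J : PlaqSpace P)
    (p : Plaq P 0) :
    curl c (WithLp.ofLp (GaxE P w c k (LinearMap.adjoint (curlOp (P := P) w c) J))) p =
      curl c (WithLp.ofLp (DkE P w c k (LinearMap.adjoint (curlOp (P := P) w c) J))) p := by
  have hs : Real.sqrt w ≠ 0 := (Real.sqrt_pos.2 hw).ne'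
  have h := LinearMap.congr_fun (eq5210_torus hk hc hw) J
  simp only [LinearMap.coe_comp, Function.comp_apply] at h
  have hp := congrArg (fun F : PlaqSpace P => F p) h
  simp only [curlOp_eq_opsV1_curl k w c, opsV1_curl] at hp
  change Real.sqrt w * curl c _ p = Real.sqrt w * curl c _ p at hp
  exact mul_left_cancel₀ hs hp

/-! ## 2. Remark 2 with the background field `u_k` of (4.5.4) -/

/-- **REMARK 2 ON THE TORI** p. 317 [PDF 19], verbatim: *"⟨f^{(k)},σ_kf^{(k)}⟩ = Σ_{p∈T_η} η^d|f_k(p)|², (5.2.11) where f_k(p) = (ie_kη²)^{−1}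
ln u_k(∂p). (5.2.12) This follows from the definition (4.5.4) of u_k …"* — for the torus σ_k (`sigmaTorus hd w η⁻¹ k`, weight `w = η^d`, curl
factor `η⁻¹`), the unit-lattice U(1) field `v = exp(ie_kB)` with plaquette field `f^{(k)} = (ie_k)^{−1} ln v(∂·)` ((4.2.4), `plaqField e
(expField e B)`), and the background field (4.5.4) `u_k = exp(ie_kη(Q^{s*}_kB − X))`, `X = 𝒟_k∂^*Q^{e*}_kf^{(k)}` (`𝒟_k = DkE`, Landau
minimizers), INSIDE THE BRANCH (2.11) of the logarithm (`|e_kη²·f_k(p)| < π` for every p — the small-field standing assumption of the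
paper): `⟨f^{(k)}, σ_kf^{(k)}⟩ = Σ_p η^d((ie_kη²)^{−1} ln u_k(∂p))²`.  Inputs: `eq5211_torus_sum` and seat p31's holonomy of (4.5.4)
`BIJ85Eq454HolonomyBase0.plaqField_background531`; `k ≤ m + K`, `2 ≤ d`, `e ≠ 0`, `η ≠ 0`, `ηL^k = 1`, `w > 0`.
[cite: BalabanImbrieJaffe1985, (5.2.11)–(5.2.12) p.317] -/
theorem rem2_torus (hd : 2 ≤ P.d) {k : ℕ} (hk : k ≤ P.m + P.K) {e : ℝ} (he : e ≠ 0) {η : ℝ} (hη0 : η ≠ 0)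
    (hη : η * (P.L : ℝ) ^ k = 1) {w : ℝ} (hw : 0 < w) (B : PBond P k → ℝ) :
    let f : UnitPlaqSpace P k := toU P k (plaqField e (expField e B))
    let X : BondSpace P := DkE P w η⁻¹ k (LinearMap.adjoint (curlOp (P := P) w η⁻¹) (QesOp (P := P) hd w k f))
    let uk : U1Field P 0 := expField (e * η) (fun b => QsstarIter k B b - X b)
    (∀ p : Plaq P 0, |e * η ^ 2 * (QestarIter hd k (plaqField e (expField e B)) p - curl η⁻¹ (WithLp.ofLp X) p)| < Real.pi) →
    ⟪f, sigmaTorus (P := P) hd w η⁻¹ k f⟫ = ∑ p : Plaq P 0, w * (plaqField (e * η ^ 2) uk p) ^ 2 := by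
  intro f X uk hsmall
  rw [eq5211_torus_sum hd hk (inv_ne_zero hη0) hw]
  refine Finset.sum_congr rfl fun p _ => ?_
  rw [plaqField_background531 hd hk he η hη B (WithLp.ofLp X) p (hsmall p)]
  rfl

/-- **(5.2.12) = (4.2.6) ON THE TORI**, verbatim p. 317: *"From this and (5.2.10) we get (ie_kη²)^{−1} ln u_k(∂p) = Q^{e*}_kf^{(k)} −
∂G_{k,Ax}∂^*Q^{e*}_kf^{(k)}, coinciding with (4.2.6)."* — with `G_{k,Ax} = GaxE` ((5.2.2) = (4.1.1)), same data and smallness as `rem2_torus`.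
[cite: BalabanImbrieJaffe1985, (5.2.12) p.317] -/
theorem eq5212_torus (hd : 2 ≤ P.d) {k : ℕ} (hk : k ≤ P.m + P.K) {e : ℝ} (he : e ≠ 0) {η : ℝ} (hη0 : η ≠ 0)
    (hη : η * (P.L : ℝ) ^ k = 1) {w : ℝ} (hw : 0 < w) (B : PBond P k → ℝ) (p : Plaq P 0) :
    let f : UnitPlaqSpace P k := toU P k (plaqField e (expField e B))
    let X : BondSpace P := DkE P w η⁻¹ k (LinearMap.adjoint (curlOp (P := P) w η⁻¹) (QesOp (P := P) hd w k f))
    let uk : U1Field P 0 := expField (e * η) (fun b => QsstarIter k B b - X b)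
    |e * η ^ 2 * (QestarIter hd k (plaqField e (expField e B)) p - curl η⁻¹ (WithLp.ofLp X) p)| < Real.pi →
    plaqField (e * η ^ 2) uk p = QestarIter hd k (plaqField e (expField e B)) p
      - curl η⁻¹ (WithLp.ofLp (GaxE P w η⁻¹ k (LinearMap.adjoint (curlOp (P := P) w η⁻¹) (QesOp (P := P) hd w k f)))) p := by
  intro f X uk hsmall
  rw [curl_GaxE_eq_curl_DkE hk (inv_ne_zero hη0) hw]
  exact plaqField_background531 hd hk he η hη B (WithLp.ofLp X) p hsmall

/-! ## 3. (6.3.2) for the gauge-field quadratic form -/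

/-- Every plaquette field `(ia)^{−1} ln u(∂p)` is gauge invariant: `u(∂p)` is (r15's `BIJ85Sect1Model.plaq_gauge`, (2.7)).
[cite: BalabanImbrieJaffe1985, (6.3.2) p.320] -/
theorem plaqField_gaugeU (a : ℝ) (h : Balaban1983to89.Site P j → Circle) (u : U1Field P j) (p : Plaq P j) :
    plaqField a (gaugeU h u) p = plaqField a u p := by
  unfold plaqField
  rw [plaq_gauge]

/-- The transformation `u ↦ u·e^{−iη∂λ}` of (6.3.2) IS the gauge transformation (2.7) by `h = e^{iλ}`: bondwise `e^{iλ(b₋)}e^{−iλ(b₊)}u_b =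
u_b·exp(−iη(∂λ)_b)` for `∂ = grad c` with `ηc = 1` (`c = η⁻¹`). [cite: BalabanImbrieJaffe1985, (6.3.2) p.320] -/
theorem gaugeU_exp_eq_translate62 (η c : ℝ) (hηc : η * c = 1) (lam : Balaban1983to89.Site P j → ℝ) (u : U1Field P j) :
    gaugeU (fun x => Circle.exp (lam x)) u = translate62 u (expField (-η) (grad c lam)) := by
  funext b
  rw [gaugeU, translate62, expField, grad]
  have h : -η * (c • (lam b.tgt - lam b.src)) = lam b.src + -(lam b.tgt) := by
    rw [smul_eq_mul]
    calc -η * (c * (lam b.tgt - lam b.src)) = -(η * c) * (lam b.tgt - lam b.src) := by ring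
      _ = lam b.src + -(lam b.tgt) := by rw [hηc]; ring
  rw [h, Circle.exp_add, Circle.exp_neg, mul_comm (u b)]

/-- **(6.3.2) for the gauge-field quadratic form written as a function of the η-lattice field** ((5.2.11)): `Σ_p w·((ia)^{−1} ln u^h(∂p))² =
Σ_p w·((ia)^{−1} ln u(∂p))²` for every gauge transformation `h`. [cite: BalabanImbrieJaffe1985, (6.3.2) p.320] -/
theorem gaugeForm_gaugeU (a w : ℝ) (h : Balaban1983to89.Site P j → Circle) (u : U1Field P j) :
    ∑ p : Plaq P j, w * (plaqField a (gaugeU h u) p) ^ 2 = ∑ p : Plaq P j, w * (plaqField a u p) ^ 2 := by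
  refine Finset.sum_congr rfl fun p _ => ?_
  rw [plaqField_gaugeU]

/-- **(6.3.2) p. 320, the gauge-field quadratic form** (*"S_k(u_ke^{−iη∂λ}, e^{iλ}φ) = S_k(u_k, φ) … it is clear in the case of the quadratic
forms for which we write explicit formulas"*): the (5.2.11)-function `u ↦ Σ_{p∈T_η} η^d|(ia)^{−1} ln u(∂p)|²` takes the same value at `u` and at
`u·e^{−iη∂λ}` (`∂ = grad c`, `ηc = 1`), for every gauge function `λ`. [cite: BalabanImbrieJaffe1985, (6.3.2) p.320] -/
theorem eq632_gaugeForm (a w η c : ℝ) (hηc : η * c = 1) (lam : Balaban1983to89.Site P j → ℝ) (u : U1Field P j) :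
    ∑ p : Plaq P j, w * (plaqField a (translate62 u (expField (-η) (grad c lam))) p) ^ 2 =
      ∑ p : Plaq P j, w * (plaqField a u p) ^ 2 := by
  rw [← gaugeU_exp_eq_translate62 η c hηc lam u, gaugeForm_gaugeU]

/-- **Remark 2 + (6.3.2)**: the torus form `⟨f^{(k)}, σ_kf^{(k)}⟩`, written by `rem2_torus` as `Σ_pη^d|(ie_kη²)^{−1} ln u_k(∂p)|²`, is ALSO
`Σ_pη^d|(ie_kη²)^{−1} ln (u_ke^{−iη∂λ})(∂p)|²` for every gauge function `λ` (same data and smallness as `rem2_torus`; `∂ = grad η⁻¹` on gauge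
functions). [cite: BalabanImbrieJaffe1985, (6.3.2) p.320] -/
theorem rem2_torus_gauge (hd : 2 ≤ P.d) {k : ℕ} (hk : k ≤ P.m + P.K) {e : ℝ} (he : e ≠ 0) {η : ℝ} (hη0 : η ≠ 0)
    (hη : η * (P.L : ℝ) ^ k = 1) {w : ℝ} (hw : 0 < w) (B : PBond P k → ℝ) (lam : Balaban1983to89.Site P 0 → ℝ) :
    let f : UnitPlaqSpace P k := toU P k (plaqField e (expField e B))
    let X : BondSpace P := DkE P w η⁻¹ k (LinearMap.adjoint (curlOp (P := P) w η⁻¹) (QesOp (P := P) hd w k f))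
    let uk : U1Field P 0 := expField (e * η) (fun b => QsstarIter k B b - X b)
    (∀ p : Plaq P 0, |e * η ^ 2 * (QestarIter hd k (plaqField e (expField e B)) p - curl η⁻¹ (WithLp.ofLp X) p)| < Real.pi) →
    ⟪f, sigmaTorus (P := P) hd w η⁻¹ k f⟫ =
      ∑ p : Plaq P 0, w * (plaqField (e * η ^ 2) (translate62 uk (expField (-η) (grad η⁻¹ lam))) p) ^ 2 := by
  intro f X uk hsmall
  rw [eq632_gaugeForm (e * η ^ 2) w η η⁻¹ (mul_inv_cancel₀ hη0) lam uk]
  exact rem2_torus hd hk he hη0 hη hw B hsmall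

end

end Literature.MathematicalPhysics.QuantumFieldTheory.BalabanImbrieJaffe1984to88.BIJ85Rem317Torus
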